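import Mathlib
import Summits.KontsevichZagierPeriods.Zeta5Search.SecondOrderDigit
import Summits.KontsevichZagierPeriods.Zeta5Search.UniversalDigitW
import HarnessLib

/-!
# ζ(5) search — the SECOND `𝒦`-digit functional `ĉ₂` of a residue class (DENOM-LAW D1, prover-d1 gen 19; definition file)

HONEST FRAMING: systematic search; no irrationality claim unless certified.  Cell `pub-zeta5`, track «DENOM-LAW» D1, seat
`denom-prover-d1` gen 19 (`HOME/denom-law/prover-d1/ATTEMPT-19.md` §2).  ONE DEFINITION, the class-level form of prover-d1 gen 15's
type functional `SecondOrder.typeC2` (`KDigitCentre.lean`), i.e. the `𝒦`-row analogue of gen-2 g10's `wHat2`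
(`SecondOrderDigit.lean` §1):

* `cHat2 b p x = ĉ₂_x := Σ_{poles q ∈ x} (ℓ_q³ ρ_{q,1} + [n_q ≥ 2] 3ℓ_q² ρ_{q,2} + [n_q ≥ 3] 2ℓ_q ρ_{q,3})` — the `ĉ`-functional
  (`UniversalDigit.cHat`) of `ηΦ_x` (substitute `ρ[ηΦ]_{ℓ,σ} = ℓρ_{ℓ,σ} + ρ_{ℓ,σ+1}` into `ĉ = Σ(ℓ²ρ₁ + 2ℓρ₂)`),

plus its unfolding over the whole class and its `p`-integrality.  It enters the CLASSWISE SECOND `𝒦`-DIGIT (`KSecondDigit.lean`):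
for a pole class with `E_x ≤ −4`, `𝒦_x ≡ (−p)^{E_x+3} ĝ_x (ĉ_x − p φ_x ĉ₂_x) (mod p^{E_x+5})` — the `𝒦`-twin of `secondDigitW_holds`
— and the second-order direction `τ_K(T) = 2ĉ₂(T) − L ĉ(T)` of THEOREM A‴ in `𝒦`-form.  Exact check of that congruence
(`denom-law/prover-d1/g19/code/kdig.py`): 1,429 / 1,429 classes with `E ≤ −4` at `p ≤ 7` (it is FALSE at `E = −3`, where the Fermat
quotient of the base survives).  `p`-adic bookkeeping of rational numbers; nothing about ζ(5), no γ; records in print UNMOVED.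
-/

noncomputable section

open Finset

namespace Summit.KontsevichZagierPeriods.Zeta5Search.SecondOrder

open Summit.KontsevichZagierPeriods.Zeta5Search.ClusterValuation
open Summit.KontsevichZagierPeriods.Zeta5Search.CasoratianValuation (InPolytope)
open Summit.KontsevichZagierPeriods.Zeta5Search.PadicSeries
open Summit.KontsevichZagierPeriods.Zeta5Search.CellA (padicNorm_classRho_le_one)

variable {p : ℕ} [hp : Fact p.Prime]

/-- `ĉ₂_x := Σ_{poles q} (ℓ_q³ ρ_{q,1} + [n_q ≥ 2] 3ℓ_q² ρ_{q,2} + [n_q ≥ 3] 2ℓ_q ρ_{q,3})` = `ĉ[ηΦ_x]`, the second `𝒦`-digit functional. -/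
def cHat2 (b : ℕ → ℤ) (p x : ℕ) : ℚ :=
  ∑ q ∈ classPoles b p x,
    ((((q / p : ℕ) : ℚ)) ^ 3 * classRho b p q 1
      + (if netExp b q ≤ -2 then 3 * (((q / p : ℕ) : ℚ)) ^ 2 * classRho b p q 2 else 0)
      + (if netExp b q ≤ -3 then 2 * ((q / p : ℕ) : ℚ) * classRho b p q 3 else 0))

omit hp in
/-- `ĉ₂_x` as a sum over the whole class (non-poles contribute `0`). -/
theorem cHat2_eq_sum_classSet (b : ℕ → ℤ) (p x : ℕ) :
    cHat2 b p x = ∑ q ∈ classSet b p x, if netExp b q < 0 then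
      ((((q / p : ℕ) : ℚ)) ^ 3 * classRho b p q 1
        + (if netExp b q ≤ -2 then 3 * (((q / p : ℕ) : ℚ)) ^ 2 * classRho b p q 2 else 0)
        + (if netExp b q ≤ -3 then 2 * ((q / p : ℕ) : ℚ) * classRho b p q 3 else 0)) else 0 := by
  rw [cHat2, classPoles, sum_filter]

omit hp in
/-- `ĉ_x` as a sum over the whole class (non-poles contribute `0`). -/
theorem cHat_eq_sum_classSet (b : ℕ → ℤ) (p x : ℕ) :
    cHat b p x = ∑ q ∈ classSet b p x, if netExp b q < 0 then
      ((((q / p : ℕ) : ℚ)) ^ 2 * classRho b p q 1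
        + (if netExp b q ≤ -2 then 2 * ((q / p : ℕ) : ℚ) * classRho b p q 2 else 0)) else 0 := by
  rw [cHat, classPoles, sum_filter]

/-- `‖ĉ₂_x‖_p ≤ 1` in the window `b₀ < p²`. -/
theorem padicNorm_cHat2_le_one (b : ℕ → ℤ) (h0 : 0 ≤ b 0) (hn : (b 0).toNat < p ^ 2) (hp2 : p ≠ 2) (x : ℕ) :
    padicNorm p (cHat2 b p x) ≤ 1 := by
  unfold cHat2
  refine padicNorm.sum_le' (fun q hq => ?_) zero_le_one
  have hqN : q ≤ (b 0).toNat := by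
    have h := (mem_filter.1 (mem_filter.1 hq).1).1
    have := mem_range.1 h; omega
  have hl : padicNorm p (((q / p : ℕ) : ℚ)) ≤ 1 := by simpa using padicNorm.of_nat (p := p) (q / p)
  have hρ : ∀ σ, padicNorm p (classRho b p q σ) ≤ 1 := fun σ => padicNorm_classRho_le_one b h0 hqN hn hp2 σ
  have hnat : ∀ n : ℕ, padicNorm p ((n : ℚ)) ≤ 1 := fun n => by simpa using padicNorm.of_nat (p := p) n
  have hpow : ∀ n : ℕ, padicNorm p ((((q / p : ℕ) : ℚ)) ^ n) ≤ 1 := fun n => by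
    have h := padicNorm.of_nat (p := p) ((q / p) ^ n)
    push_cast at h
    exact h
  have hmul : ∀ {a c : ℚ}, padicNorm p a ≤ 1 → padicNorm p c ≤ 1 → padicNorm p (a * c) ≤ 1 := fun ha hc => by
    rw [padicNorm.mul]; exact mul_le_one₀ ha (padicNorm.nonneg _) hc
  refine (padicNorm.nonarchimedean (p := p)).trans (max_le ((padicNorm.nonarchimedean (p := p)).trans (max_le ?_ ?_)) ?_)
  · exact hmul (hpow 3) (hρ 1)
  · split_ifs
    · exact hmul (hmul (by simpa using hnat 3) (hpow 2)) (hρ 2)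
    · simp
  · split_ifs
    · exact hmul (hmul (by simpa using hnat 2) hl) (hρ 3)
    · simp

end Summit.KontsevichZagierPeriods.Zeta5Search.SecondOrder

end
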